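import Summits.Ventures.PercRepro.RankLevelSetHallLostInj

/-!
# PercRepro — THE HALL CONDITION OF THE LOST SETS GIVES THE UP-HALL FORM AT THE TIGHT LAYER (p4, gen 33; C-044, UP form;
paper proofs/P4-CELL-THREE.md §14.20)

RankLevelSetHallLostInj reduces the UP-Hall form of C-044 at the tight layer `#E = p + q` to an INJECTION of the lost sets
(`r(S) = q`, `q < #S < p`, `S ⊇` a member) into the big `Y`-sets `T ⊇ S` (`#T ≥ p`, `q < r(T) < p`).  By Hall's marriage
theorem (Mathlib's `Finset.all_card_le_biUnion_card_iff_exists_injective`) such an injection exists as soon as the HALL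
CONDITION holds: every family `ℒ` of lost sets has at least `#ℒ` big `Y`-sets containing some member of `ℒ`
(`LostHall M p q`, a `Prop`, NOT asserted — it holds on every matroid with at most 9 elements and on every adversarial
family tested, by exact maximum-matching computations; §14.20).  So the conjecture of record for the mechanism can be
stated WITHOUT any rule: `LostHall` is a pure counting condition on the lost sets and the big sets.
* `bigY_finite`, `LostHall`;
* `lostInj_of_lostHall` — Hall's theorem, instantiated;
* **`hallUp_of_ncard_eq_of_lostHall`** — `#E = p + q`, `q < p`, `LostHall M p q` ⇒ `Φ(p,q)·#𝒜 ≤ #upNbhd(𝒜)` for every family.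
Axioms: standard.
-/

namespace PercRepro

open Set Matroid Finset

variable {α : Type} (M : Matroid α) [M.Finite]

/-- The big `Y`-sets form a finite family. -/
theorem bigY_finite (p q : ℕ) : (bigY M p q).Finite :=
  (cellY_finite M p q).subset (fun _ hT => hT.1)

/-- **The Hall condition of the lost sets** — a `Prop`, NOT asserted: every family `ℒ` of lost sets has at least `#ℒ`
big `Y`-sets containing some member of `ℒ`. -/
def LostHall (p q : ℕ) : Prop :=
  ∀ ℒ ⊆ lostSets M p q, ℒ.ncard ≤ {T : Set α | T ∈ bigY M p q ∧ ∃ S ∈ ℒ, S ⊆ T}.ncard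

/-- **Hall's marriage theorem for the lost sets**: the Hall condition gives an injection of the lost sets into the big
`Y`-sets, `S ⊆ φ S`. -/
theorem lostInj_of_lostHall (p q : ℕ) (h : LostHall M p q) : LostInj M p q := by
  classical
  -- the bipartite data: a lost set `S` may go to the big `Y`-sets containing it
  let t : (lostSets M p q) → Finset (Set α) :=
    fun S => (bigY_finite M p q).toFinset.filter (fun T => (S : Set α) ⊆ T)
  have hmem : ∀ (S : lostSets M p q) (T : Set α), T ∈ t S ↔ T ∈ bigY M p q ∧ (S : Set α) ⊆ T := by
    intro S T
    simp only [t, Finset.mem_filter, (bigY_finite M p q).mem_toFinset]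
  -- Hall's condition in Mathlib's form
  have hhall : ∀ s : Finset (lostSets M p q), s.card ≤ (s.biUnion t).card := by
    intro s
    set ℒ : Set (Set α) := ((s.image (fun S : lostSets M p q => (S : Set α)) : Finset (Set α)) : Set (Set α)) with hℒ
    have hℒsub : ℒ ⊆ lostSets M p q := by
      intro S hS
      rw [hℒ, Finset.coe_image] at hS
      obtain ⟨S', -, rfl⟩ := hS
      exact S'.2
    have hcard : ℒ.ncard = s.card := by
      rw [hℒ, ncard_coe_finset, Finset.card_image_of_injective _ Subtype.val_injective]
    have hnbhd : {T : Set α | T ∈ bigY M p q ∧ ∃ S ∈ ℒ, S ⊆ T} = ((s.biUnion t : Finset (Set α)) : Set (Set α)) := by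
      ext T
      simp only [Set.mem_setOf_eq, Finset.coe_biUnion, Set.mem_iUnion, Finset.mem_coe, hmem, hℒ, Finset.coe_image,
        Set.mem_image, exists_prop, exists_exists_and_eq_and]
      constructor
      · rintro ⟨hT, S, hS, hST⟩
        exact ⟨S, hS, hT, hST⟩
      · rintro ⟨S, hS, hT, hST⟩
        exact ⟨hT, S, hS, hST⟩
    have := h ℒ hℒsub
    rw [hcard, hnbhd, ncard_coe_finset] at this
    exact this
  obtain ⟨f, hfinj, hf⟩ := (Finset.all_card_le_biUnion_card_iff_exists_injective t).1 hhall
  refine ⟨fun S => if hS : S ∈ lostSets M p q then f ⟨S, hS⟩ else S, ?_, ?_⟩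
  · intro S hS
    simp only [dif_pos hS]
    exact (hmem ⟨S, hS⟩ _).1 (hf ⟨S, hS⟩)
  · intro S₁ hS₁ S₂ hS₂ heq
    simp only [dif_pos hS₁, dif_pos hS₂] at heq
    have := hfinj heq
    exact congrArg Subtype.val this

/-- **THE TRANSFER, HALL FORM**: at the tight layer `#E = p + q` with `q < p`, the Hall condition of the lost sets gives the
UP-Hall condition for every family of members. -/
theorem hallUp_of_ncard_eq_of_lostHall (p q : ℕ) (hE : M.E.ncard = p + q) (hpq : q < p) (h : LostHall M p q)
    (𝒜 : Set (Set α)) (h𝒜 : 𝒜 ⊆ cellMembers M p q) :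
    phiK p q * (𝒜.ncard : ℚ) ≤ ((upNbhd M p q 𝒜).ncard : ℚ) :=
  hallUp_of_ncard_eq_of_lostInj M p q hE hpq (lostInj_of_lostHall M p q h) 𝒜 h𝒜

end PercRepro
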